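import Literature.NumberTheory.ComplexMultiplication.CMTypeRankSameSlotFamilies
import HarnessLib

/-!
# Right ideals, I: the rank of a family of CM types EQUALS the dimension of its matrix-coefficient space — row rank =
# column rank for the translate matrix; exact DEFECT formulas `Σ_i dim Hg(A_i) − dim Hg(∏_i A_i) = Σ_i dim MC_i − dim Σ_i MC_i`

COR-CM (cell `pub-hodgecm2`, binder seat `b16` gen 64, count-neutral claim RIGHT IDEALS, file R1 — abstract `G`-set
level; theorems only, no definition, no named fact, no `sorry`).  NEW as stated, hence under `Summits/`.  HONEST FRAMING:
finite-dimensional linear algebra about the Kubota–Dodson rank of a family of CM types, read on the Hodge groups of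
products of abelian varieties with complex multiplication; `HC_CM` is neither used nor asserted.

SETTING (tree: `Literature/…/CMTypeRank`, `…/CMTypeRankFamilies`; seat gen 54 `CorCM/CommonCoefficientCriterion`).  A
group `G` acts on finite slots `E_i` (`G = Aut(ℂ)` or `Gal(L/ℚ)`, `E_i = Hom(K_i, ℂ)`); types `Φ_i ⊆ E_i`, type vectors
`u_i = u_1(Φ_i) = 2·𝟙_{Φ_i} − 1`, translate modules `U(Φ_i) = span{u_i(g·) : g ∈ G} ≤ ℚ^{E_i}` and `U(Σ) ≤ ℚ^{⊔E_i}` of the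
family type `Σ` (`rank − 1 = dim U`; `dim U(Σ) = dim Hg(∏_i A_i)`, `dim U(Φ_i) = dim Hg(A_i)`, Deligne's Ex. 3.7).  The
TRANSLATE MATRIX of `Σ` has rows `g ∈ G` and columns `(i, x) ∈ ⊔E_i`, entry `u_i(g·x)`: its ROW space is `U(Σ)`; its
COLUMN space is the sum `Σ_i MC_i ≤ ℚ^G` of the MATRIX-COEFFICIENT SPACES `MC_i = span{c_{i,x} : x ∈ E_i}`,
`c_{i,x}(g) = u_i(g·x)`, of gen 54's `CommonCoefficientCriterion` — which proved, through dual annihilators, the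
QUALITATIVE criterion: the family is additive iff every linear relation among the matrix coefficients splits slot by
slot (iff the `MC_i` are independent).  On the Mumford–Tate side `c_{i,x}` is the character `e_{i,x}` of `∏_i T^{K_i}`
restricted to `MT(∏_i A_i)`, written as a function on the generating Galois orbit `{σμ}` of the Hodge cocharacter
([Deligne1982HodgeCycles, I.3.4; I.5 p. 53: "the Mumford–Tate group of `A` is contained in the product of those of the
`A_α`"]), so `Σ_i MC_i = X^*(MT(∏ A_i))_ℚ` and `MC_i = X^*(MT(A_i))_ℚ`; "the rank equals the rank of the dual" is
[Ribet1980, (3.3)] for one type.  THIS FILE proves the dimension IDENTITY, hence EXACT defect counts where the tree's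
criteria (evaluation criterion, common coefficient, the seat's `…ShadowIdeals*`) decide only whether the defect is `0`.

* §1 **`finrank_span_range_eq_finrank_span_range_swap`** — ROW RANK = COLUMN RANK for a matrix `A : α → β → ℚ` with
  finitely many columns and ANY row index type (`G = Aut(ℂ)` is allowed): through `LinearMap.dualMap` of
  `ℚ^{(α)} → ℚ^β`, no finiteness of `α`.
* §2 **`finrank_antiSpan_eq_finrank_span_coeff`**, **`finrank_antiSpan_sigmaType_eq_finrank_iSup_span_coeff`**:
  `dim U(Φ) = dim MC(Φ)` and **`dim U(Σ) = dim (⨆_i MC_i)`** — all the `MC_i` live in the ONE space `ℚ^G`, whatever the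
  slots.
* §3 THE DEFECT FORMULAS: `typeRank_sigmaType_add_card_add_sum_finrank_eq` —
  `rank(Σ) + |I| + Σ_i dim MC_i = Σ_i rank(Φ_i) + 1 + dim(⨆_i MC_i)`, i.e. **`Σ_i dim Hg(A_i) − dim Hg(∏_i A_i) =
  Σ_i dim MC_i − dim Σ_i MC_i`** (the dimension of the space of linear relations among the `MC_i`); hence
  `typeRank_sigmaType_add_card_eq_iff_finrank_iSup_eq_sum` / `…_iff_iSupIndep` (gen 54's criterion in Mathlib's
  `iSupIndep` currency), and for a pair **`typeRank_add_typeRank_eq_of_pair`**: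
  `rank Φ₀ + rank Φ₁ = rank(Φ₀, Φ₁) + 1 + dim(MC₀ ∩ MC₁)`, i.e. **`dim Hg(A₀) + dim Hg(A₁) − dim Hg(A₀ × A₁) =
  dim(MC₀ ∩ MC₁)`** — the codimension of `Hg(A₀ × A₁)` in `Hg(A₀) × Hg(A₁)` is the dimension of the space of COMMON
  matrix coefficients.
* File R1b `IrreducibleOddWeightsRightIdealsFree`: FREE slots (`G` finite acting on itself) — `MC_i = u_i·ℚ[G]` is the
  RIGHT ideal generated by `u_i` while `U(Φ_i) = ℚ[G]·u_i` is the LEFT ideal; `dim Hg(∏ A_i) = dim Σ_i u_iℚ[G]`; the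
  reflex reading `dim Hg(∏_i A_i) = dim Σ_i U(Φ_i⁻¹)` through the inverse types.
* Sequels: R2 `IrreducibleOddWeightsRightIdealsCMFields` (Galois model: `dim MT(∏_i A_i) = 1 + dim Σ_i ũ_iℚ[Gal(L/ℚ)]`,
  Hodge side), R3 `IrreducibleOddWeightsRightIdealsPivot` (the exact defect read on a Galois PIVOT:
  `dim Hg(A₀) + dim Hg(A₁) − dim Hg(A₀ × A₁) = dim(w₀ℚ[Γ] ∩ w₁ℚ[Γ])` for the shadows `w_κ`).

## References

* [Deligne1982HodgeCycles] P. Deligne, *Hodge cycles on abelian varieties*, LNM 900 (1982), I.3.4, I.5 (p. 53), I Ex. 3.7.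
* [Ribet1980] K. A. Ribet, *Division fields of abelian varieties with complex multiplication*, Mém. SMF 2 (1980), §3
  (3.3) ("the rank of a CM type is equal to the rank of its dual").
* [Kubota1965] T. Kubota, *On the field extension by complex multiplication*, Trans. AMS 118 (1965), §2 Lemma 1–2.
* [Gordon1999HodgeAVSurvey] B. B. Gordon, *A survey of the Hodge conjecture for abelian varieties*, §3 Theorem (Imai,
  Murty) with proof, 7.5–7.7, 9.1.

Provenance: Literature home (family `hodge`, namespace `Literature.NumberTheory.ComplexMultiplication.IrrOdd`) of the Summits-side `CorCM/IrreducibleOddWeightsRightIdeals` (cell `pub-hodgecm2`, COR-CM; all its imports are `Literature/` and Mathlib), which `Literature/` may not import; theorems only, no named fact, no definition. Nothing here bears on `HC_CM`. Lane `lit-hodgefound` (Layer A3: CM types, their Kubota ranks and Galois combinatorics), seat p20.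
-/

set_option autoImplicit false

noncomputable section

open scoped BigOperators Pointwise

universe u v w

namespace Literature.NumberTheory.ComplexMultiplication.IrrOdd

open Literature.NumberTheory.ComplexMultiplication

/-! ### §1 Row rank = column rank, for any row index type -/

section Transpose

/-- **ROW RANK = COLUMN RANK, coordinate-free and with an arbitrary row index type**: for `A : α → β → ℚ` with `β`
finite, the span of the rows `A a ∈ ℚ^β` and the span of the columns `(a ↦ A a b) ∈ ℚ^α` have the same (finite)
dimension — the dual map of `ℚ^{(α)} → ℚ^β`, `δ_a ↦ A a`, read through `(ℚ^{(α)})^* = ℚ^α`, has the columns as its values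
on the coordinate functionals. [cite: Ribet1980, §3 (3.3)] -/
theorem finrank_span_range_eq_finrank_span_range_swap {α : Type u} {β : Type v} [Fintype β] (A : α → β → ℚ) :
    Module.finrank ℚ (Submodule.span ℚ (Set.range A)) =
      Module.finrank ℚ (Submodule.span ℚ (Set.range fun b : β => fun a : α => A a b)) := by
  classical
  let f : (α →₀ ℚ) →ₗ[ℚ] (β → ℚ) := Finsupp.linearCombination ℚ A
  have hf : LinearMap.range f = Submodule.span ℚ (Set.range A) := Finsupp.range_linearCombination ℚ
  let e : Module.Dual ℚ (α →₀ ℚ) ≃ₗ[ℚ] (α → ℚ) := (Finsupp.llift ℚ ℚ ℚ α).symm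
  have he : ∀ (φ : Module.Dual ℚ (α →₀ ℚ)) (a : α), e φ a = φ (Finsupp.single a 1) := fun φ a =>
    Finsupp.llift_symm_apply _ _ _ _ φ a
  -- a functional on `ℚ^β` is the dot product with its values on the basis vectors
  have hφ : ∀ (φ : Module.Dual ℚ (β → ℚ)) (v : β → ℚ), φ v = ∑ b, v b * φ (Pi.single b 1) := by
    intro φ v
    conv_lhs => rw [show v = ∑ b, v b • (Pi.single b 1 : β → ℚ) from by
      funext x
      simp only [Finset.sum_apply, Pi.smul_apply, Pi.single_apply, smul_eq_mul, mul_ite, mul_one, mul_zero,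
        Finset.sum_ite_eq, Finset.mem_univ, if_true]]
    rw [map_sum]
    exact Finset.sum_congr rfl fun b _ => by rw [map_smul, smul_eq_mul]
  have hrange : Submodule.map (e : Module.Dual ℚ (α →₀ ℚ) →ₗ[ℚ] (α → ℚ)) (LinearMap.range f.dualMap) =
      Submodule.span ℚ (Set.range fun b : β => fun a : α => A a b) := by
    apply le_antisymm
    · rintro _ ⟨ψ, ⟨φ, rfl⟩, rfl⟩
      have hval : (e : Module.Dual ℚ (α →₀ ℚ) →ₗ[ℚ] (α → ℚ)) (f.dualMap φ) =
          ∑ b, φ (Pi.single b 1) • (fun a : α => A a b) := by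
        funext a
        rw [LinearEquiv.coe_coe, he, LinearMap.dualMap_apply, Finset.sum_apply]
        simp only [f, Finsupp.linearCombination_single, one_smul, Pi.smul_apply, smul_eq_mul]
        rw [hφ φ (A a)]
        exact Finset.sum_congr rfl fun b _ => mul_comm _ _
      rw [hval]
      exact Submodule.sum_mem _ fun b _ => Submodule.smul_mem _ _ (Submodule.subset_span ⟨b, rfl⟩)
    · rw [Submodule.span_le]
      rintro _ ⟨b, rfl⟩
      refine ⟨f.dualMap (LinearMap.proj b), ⟨LinearMap.proj b, rfl⟩, ?_⟩
      funext a
      rw [LinearEquiv.coe_coe, he, LinearMap.dualMap_apply]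
      simp only [f, Finsupp.linearCombination_single, one_smul, LinearMap.coe_proj, Function.eval]
  rw [← hf, ← LinearMap.finrank_range_dualMap_eq_finrank_range f, ← hrange]
  exact (LinearEquiv.finrank_map_eq e _).symm

end Transpose

/-! ### §2 The translate module and the coefficient space have the same dimension -/

section Coefficient

variable {G : Type w} [Group G] {X : Type v} [MulAction G X] [Fintype X]

/-- **`dim span{f(g·) : g ∈ G} = dim span{c_x : x ∈ X}`, `c_x(g) = f(g·x)`** — the translate module of a vector on a
finite `G`-set and its COEFFICIENT SPACE in `ℚ^G` have the same dimension (row and column space of the translate matrix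
`(g, x) ↦ f(g·x)`; `G` need not be finite). [cite: Ribet1980, §3 (3.3)] -/
theorem finrank_span_translates_eq_finrank_span_coeff (f : X → ℚ) :
    Module.finrank ℚ (Submodule.span ℚ (Set.range fun g : G => fun x : X => f (g • x))) =
      Module.finrank ℚ (Submodule.span ℚ (Set.range fun x : X => fun g : G => f (g • x))) :=
  finrank_span_range_eq_finrank_span_range_swap (fun (g : G) (x : X) => f (g • x))

omit [Fintype X] in
/-- The `±1`-vector of a translate is the base `±1`-vector moved: `u_g(x) = u_1(g·x)`. [cite: Kubota1965, §2] -/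
theorem antiVec_apply_eq_antiVec_one_smul (Φ : Set X) (g : G) (x : X) :
    antiVec Φ g x = antiVec Φ (1 : G) (g • x) := by
  simp only [antiVec, ← translateInd_mul, one_mul]

/-- The coefficient space of a type on a finite slot is finite-dimensional (finitely many `c_x`). [cite: Ribet1980, §3 (3.3)] -/
theorem finite_span_coeff (Φ : Set X) :
    Module.Finite ℚ (Submodule.span ℚ (Set.range fun x : X => fun g : G => antiVec Φ g x)) :=
  Module.Finite.span_of_finite ℚ (Set.finite_range _)

/-- **`dim U(Φ) = dim C(Φ)`**: the translate module `U(Φ) = span{u_g}` of a type (`rank Φ − 1 = dim Hg(A_Φ)`) and its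
coefficient space `C(Φ) = span{c_x : x ∈ X} ≤ ℚ^G`, `c_x(g) = u_g(x) = u_1(g·x)` (the character `e_x` of the torus
`T^K` restricted to `MT(A_Φ)`, as a function on the Galois orbit of the Hodge cocharacter) have the same dimension.
[cite: Ribet1980, §3 (3.3)] [cite: Deligne1982HodgeCycles, I.3.4 and I Ex. 3.7] -/
theorem finrank_antiSpan_eq_finrank_span_coeff (Φ : Set X) :
    Module.finrank ℚ (antiSpan G Φ) =
      Module.finrank ℚ (Submodule.span ℚ (Set.range fun x : X => fun g : G => antiVec Φ g x)) :=
  finrank_span_range_eq_finrank_span_range_swap (fun (g : G) (x : X) => antiVec Φ g x)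

variable {I : Type u} {E : I → Type v} [∀ i, MulAction G (E i)] [∀ i, Fintype (E i)] [Fintype I]

omit [Fintype X] [MulAction G X] [∀ i, Fintype (E i)] [Fintype I] in
/-- The coefficient space of the family type is the SUM of the coefficient spaces of the members, all inside the one
space `ℚ^G`: `span{c_{(i,x)}} = ⨆_i span{c_{i,x} : x ∈ E_i}` (`c_{(i,x)}(g) = u_g(Σ)(i,x) = u_g(Φ_i)(x)`).
[cite: Deligne1982HodgeCycles, I Ex. 3.7 (c)] -/
theorem span_coeff_sigmaType_eq_iSup (Φ : ∀ i, Set (E i)) :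
    Submodule.span ℚ (Set.range fun p : (Σ i, E i) => fun g : G => antiVec (sigmaType Φ) g p) =
      ⨆ i, Submodule.span ℚ (Set.range fun x : E i => fun g : G => antiVec (Φ i) g x) := by
  rw [← Submodule.span_iUnion]
  congr 1
  ext c
  simp only [Set.mem_range, Set.mem_iUnion]
  constructor
  · rintro ⟨⟨i, x⟩, rfl⟩
    exact ⟨i, x, funext fun g => (antiVec_sigmaType Φ g ⟨i, x⟩).symm⟩
  · rintro ⟨i, x, rfl⟩
    exact ⟨⟨i, x⟩, funext fun g => antiVec_sigmaType Φ g ⟨i, x⟩⟩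

omit [Fintype X] [MulAction G X] in
/-- **`dim U(Σ) = dim ⨆_i C_i`** — the translate module of the family type (`dim Hg(∏_i A_i)`) has the dimension of the
SUM of the coefficient spaces `C_i = span{g ↦ u_1(Φ_i)(g·x) : x ∈ E_i}` of the members, taken inside the one space
`ℚ^G` (`X^*(MT(∏ A_i))_ℚ = Σ_i X^*(MT(A_i))_ℚ`). [cite: Deligne1982HodgeCycles, I.5 (p. 53) and I Ex. 3.7 (c)]
[cite: Ribet1980, §3 (3.3)] -/
theorem finrank_antiSpan_sigmaType_eq_finrank_iSup_span_coeff (Φ : ∀ i, Set (E i)) :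
    Module.finrank ℚ (antiSpan G (sigmaType Φ)) =
      Module.finrank ℚ (⨆ i, Submodule.span ℚ (Set.range fun x : E i => fun g : G => antiVec (Φ i) g x) :
        Submodule ℚ (G → ℚ)) := by
  rw [finrank_antiSpan_eq_finrank_span_coeff, span_coeff_sigmaType_eq_iSup]

end Coefficient

/-! ### §3 The defect formulas -/

section Defect

/-- `dim (⨆_i B_i) + dim ker = Σ_i dim B_i` for the summation map `⨁_i B_i → ⨆_i B_i`; in particular
`dim (⨆_i B_i) ≤ Σ_i dim B_i` with equality iff the family is independent. [cite: Ribet1980, §3 (3.3)] -/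
theorem finrank_iSup_add_finrank_ker_lsum_eq_sum {M : Type*} [AddCommGroup M] [Module ℚ M] {ι : Type*} [Fintype ι]
    [DecidableEq ι] (B : ι → Submodule ℚ M) [∀ i, Module.Finite ℚ (B i)] :
    Module.finrank ℚ (⨆ i, B i : Submodule ℚ M) +
        Module.finrank ℚ (LinearMap.ker (DFinsupp.lsum ℕ (M := fun i => ↥(B i)) fun i => (B i).subtype)) =
      ∑ i, Module.finrank ℚ (B i) := by
  have hrange : LinearMap.range (DFinsupp.lsum ℕ (M := fun i => ↥(B i)) fun i => (B i).subtype) = ⨆ i, B i :=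
    (Submodule.iSup_eq_range_dfinsupp_lsum B).symm
  haveI : Module.Finite ℚ (Π₀ i, ↥(B i)) := Module.Finite.equiv (DirectSum.linearEquivFunOnFintype ℚ ι _).symm
  rw [← hrange, LinearMap.finrank_range_add_finrank_ker, ← Module.finrank_directSum]
  rfl

/-- `dim (⨆_i B_i) = Σ_i dim B_i` iff the `B_i` are INDEPENDENT (the summation map `⨁_i B_i → M` is injective).
 [cite: Ribet1980, §3 (3.3)] -/
theorem finrank_iSup_eq_sum_finrank_iff_iSupIndep {M : Type*} [AddCommGroup M] [Module ℚ M] {ι : Type*} [Fintype ι]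
    (B : ι → Submodule ℚ M) [∀ i, Module.Finite ℚ (B i)] :
    Module.finrank ℚ (⨆ i, B i : Submodule ℚ M) = ∑ i, Module.finrank ℚ (B i) ↔ iSupIndep B := by
  classical
  haveI : Module.Finite ℚ (Π₀ i, ↥(B i)) := Module.Finite.equiv (DirectSum.linearEquivFunOnFintype ℚ ι _).symm
  have h := finrank_iSup_add_finrank_ker_lsum_eq_sum B
  rw [iSupIndep_iff_dfinsupp_lsum_injective, ← LinearMap.ker_eq_bot, ← Submodule.finrank_eq_zero]
  omega

variable {G : Type w} [Group G] {I : Type u} {E : I → Type v} [∀ i, MulAction G (E i)] [∀ i, Fintype (E i)]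
  [Fintype I]

/-- **THE DEFECT FORMULA**: `rank(Σ) + |I| + Σ_i dim C_i = Σ_i rank(Φ_i) + 1 + dim(⨆_i C_i)`, i.e.
**`Σ_i dim Hg(A_i) − dim Hg(∏_i A_i) = Σ_i dim C_i − dim Σ_i C_i`** — the additivity defect of the family is the
dimension of the space of linear relations among the coefficient spaces `C_i ≤ ℚ^G`.
[cite: Deligne1982HodgeCycles, I.5 (p. 53) and I Ex. 3.7 (c)] [cite: Gordon1999HodgeAVSurvey, §3 Theorem (proof) and 7.7] -/
theorem typeRank_sigmaType_add_card_add_sum_finrank_eq [Nonempty I] [∀ i, Nonempty (E i)] {ρ : G}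
    {Φ : ∀ i, Set (E i)} (h : ∀ i, IsCMTypeWith ρ (Φ i)) :
    typeRank G (sigmaType Φ) + Fintype.card I +
        ∑ i, Module.finrank ℚ (Submodule.span ℚ (Set.range fun x : E i => fun g : G => antiVec (Φ i) g x)) =
      (∑ i, typeRank G (Φ i)) + 1 +
        Module.finrank ℚ (⨆ i, Submodule.span ℚ (Set.range fun x : E i => fun g : G => antiVec (Φ i) g x) :
          Submodule ℚ (G → ℚ)) := by
  obtain ⟨i₀⟩ := ‹Nonempty I›
  haveI : Nonempty (Σ i, E i) := ⟨⟨i₀, Classical.arbitrary (E i₀)⟩⟩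
  rw [(IsCMTypeWith.sigmaType h).typeRank_eq_finrank_antiSpan_add_one,
    Finset.sum_congr rfl fun i _ => (h i).typeRank_eq_finrank_antiSpan_add_one, Finset.sum_add_distrib,
    Finset.sum_const, Finset.card_univ, smul_eq_mul, mul_one, finrank_antiSpan_sigmaType_eq_finrank_iSup_span_coeff,
    Finset.sum_congr rfl fun i _ => finrank_antiSpan_eq_finrank_span_coeff (G := G) (Φ i)]
  omega

/-- **`Hg(∏_i A_i) = ∏_i Hg(A_i)` IFF `dim(⨆_i C_i) = Σ_i dim C_i`**: the family is additive
(`rank(Σ) + |I| = Σ_i rank(Φ_i) + 1`) iff the coefficient spaces add up their dimensions.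
[cite: Gordon1999HodgeAVSurvey, §3 Theorem and 7.5–7.7] [cite: Deligne1982HodgeCycles, I Ex. 3.7 (c)] -/
theorem typeRank_sigmaType_add_card_eq_iff_finrank_iSup_eq_sum [Nonempty I] [∀ i, Nonempty (E i)] {ρ : G}
    {Φ : ∀ i, Set (E i)} (h : ∀ i, IsCMTypeWith ρ (Φ i)) :
    typeRank G (sigmaType Φ) + Fintype.card I = (∑ i, typeRank G (Φ i)) + 1 ↔
      Module.finrank ℚ (⨆ i, Submodule.span ℚ (Set.range fun x : E i => fun g : G => antiVec (Φ i) g x) :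
          Submodule ℚ (G → ℚ)) =
        ∑ i, Module.finrank ℚ (Submodule.span ℚ (Set.range fun x : E i => fun g : G => antiVec (Φ i) g x)) := by
  have := typeRank_sigmaType_add_card_add_sum_finrank_eq h
  omega

/-- **`Hg(∏_i A_i) = ∏_i Hg(A_i)` IFF THE COEFFICIENT SPACES `C_i ≤ ℚ^G` ARE INDEPENDENT** (`X^*` of the factors meet
only trivially inside `X^*(MT(∏ A_i))_ℚ`). [cite: Gordon1999HodgeAVSurvey, §3 Theorem and 7.5–7.7]
[cite: Deligne1982HodgeCycles, I.5 (p. 53)] -/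
theorem typeRank_sigmaType_add_card_eq_iff_iSupIndep [Nonempty I] [∀ i, Nonempty (E i)] {ρ : G}
    {Φ : ∀ i, Set (E i)} (h : ∀ i, IsCMTypeWith ρ (Φ i)) :
    typeRank G (sigmaType Φ) + Fintype.card I = (∑ i, typeRank G (Φ i)) + 1 ↔
      iSupIndep fun i => Submodule.span ℚ (Set.range fun x : E i => fun g : G => antiVec (Φ i) g x) := by
  haveI := fun i => finite_span_coeff (G := G) (Φ i)
  rw [typeRank_sigmaType_add_card_eq_iff_finrank_iSup_eq_sum h, finrank_iSup_eq_sum_finrank_iff_iSupIndep]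

/-- Additivity in the tree's currency `ext_i U(Φ_i) ≤ U(Σ)` iff the coefficient spaces are independent.
[cite: Gordon1999HodgeAVSurvey, §3 Theorem (proof)] -/
theorem forall_map_slotExt_le_iff_iSupIndep [DecidableEq I] [Nonempty I] [∀ i, Nonempty (E i)] {ρ : G}
    {Φ : ∀ i, Set (E i)} (h : ∀ i, IsCMTypeWith ρ (Φ i)) :
    (∀ i, (antiSpan G (Φ i)).map (slotExt i) ≤ antiSpan G (sigmaType Φ)) ↔
      iSupIndep fun i => Submodule.span ℚ (Set.range fun x : E i => fun g : G => antiVec (Φ i) g x) := by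
  rw [forall_map_slotExt_le_iff_typeRank_sigmaType_add_card_eq h, typeRank_sigmaType_add_card_eq_iff_iSupIndep h]

omit [Fintype I] in
/-- Over a two-element index set `{i₀, i₁}` the `⨆` is `C_{i₀} ⊔ C_{i₁}`. [cite: Ribet1980, §3 (3.3)] -/
theorem iSup_eq_sup_of_pair {M : Type*} [AddCommGroup M] [Module ℚ M] (C : I → Submodule ℚ M) {i₀ i₁ : I}
    (hI : ∀ j, j = i₀ ∨ j = i₁) : (⨆ i, C i) = C i₀ ⊔ C i₁ := by
  apply le_antisymm
  · refine iSup_le fun j => ?_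
    rcases hI j with rfl | rfl
    · exact le_sup_left
    · exact le_sup_right
  · exact sup_le (le_iSup C i₀) (le_iSup C i₁)

/-- Over a two-element index set a sum is the sum of the two values. [cite: Ribet1980, §3 (3.3)] -/
theorem sum_eq_add_of_pair (a : I → ℕ) {i₀ i₁ : I} (hI : ∀ j, j = i₀ ∨ j = i₁) (h01 : i₀ ≠ i₁) :
    ∑ i, a i = a i₀ + a i₁ := by
  rw [Fintype.sum_eq_add i₀ i₁ h01]
  intro j hj
  rcases hI j with rfl | rfl
  · exact absurd rfl hj.1
  · exact absurd rfl hj.2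

/-- **THE PAIR DEFECT: `rank Φ₀ + rank Φ₁ = rank(Φ₀, Φ₁) + 1 + dim(C₀ ∩ C₁)`**, i.e.
**`dim Hg(A₀) + dim Hg(A₁) − dim Hg(A₀ × A₁) = dim(C₀ ∩ C₁)`** — the codimension of `Hg(A₀ × A₁)` in `Hg(A₀) × Hg(A₁)`
is the dimension of the INTERSECTION of the two coefficient spaces in `ℚ^G`; the tree's criteria decide when it is `0`.
[cite: Gordon1999HodgeAVSurvey, §3 Theorem (proof) and 7.5–7.7] [cite: Deligne1982HodgeCycles, I.5 (p. 53)] -/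
theorem typeRank_add_typeRank_eq_of_pair [∀ i, Nonempty (E i)] {ρ : G} {Φ : ∀ i, Set (E i)}
    (h : ∀ i, IsCMTypeWith ρ (Φ i)) {i₀ i₁ : I} (hI : ∀ j, j = i₀ ∨ j = i₁) (h01 : i₀ ≠ i₁) :
    typeRank G (Φ i₀) + typeRank G (Φ i₁) = typeRank G (sigmaType Φ) + 1 +
      Module.finrank ℚ (Submodule.span ℚ (Set.range fun x : E i₀ => fun g : G => antiVec (Φ i₀) g x) ⊓
        Submodule.span ℚ (Set.range fun x : E i₁ => fun g : G => antiVec (Φ i₁) g x) : Submodule ℚ (G → ℚ)) := by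
  haveI : Nonempty I := ⟨i₀⟩
  haveI := fun i => finite_span_coeff (G := G) (Φ i)
  have hdef := typeRank_sigmaType_add_card_add_sum_finrank_eq h
  have hcard : Fintype.card I = 2 := by
    classical
    rw [← Finset.card_univ, show (Finset.univ : Finset I) = {i₀, i₁} from Finset.ext fun j => by
      simpa only [Finset.mem_univ, Finset.mem_insert, Finset.mem_singleton, true_iff] using hI j,
      Finset.card_pair h01]
  rw [iSup_eq_sup_of_pair _ hI, sum_eq_add_of_pair _ hI h01, sum_eq_add_of_pair _ hI h01, hcard] at hdef
  have hsup := Submodule.finrank_sup_add_finrank_inf_eq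
    (Submodule.span ℚ (Set.range fun x : E i₀ => fun g : G => antiVec (Φ i₀) g x))
    (Submodule.span ℚ (Set.range fun x : E i₁ => fun g : G => antiVec (Φ i₁) g x))
  omega

/-- **`Hg(A₀ × A₁) = Hg(A₀) × Hg(A₁)` iff `C₀ ∩ C₁ = 0`.** [cite: Gordon1999HodgeAVSurvey, §3 Theorem and 7.5–7.7] -/
theorem typeRank_sigmaType_add_card_eq_iff_inf_eq_bot_of_pair [∀ i, Nonempty (E i)] {ρ : G} {Φ : ∀ i, Set (E i)}
    (h : ∀ i, IsCMTypeWith ρ (Φ i)) {i₀ i₁ : I} (hI : ∀ j, j = i₀ ∨ j = i₁) (h01 : i₀ ≠ i₁) :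
    typeRank G (sigmaType Φ) + Fintype.card I = (∑ i, typeRank G (Φ i)) + 1 ↔
      Submodule.span ℚ (Set.range fun x : E i₀ => fun g : G => antiVec (Φ i₀) g x) ⊓
        Submodule.span ℚ (Set.range fun x : E i₁ => fun g : G => antiVec (Φ i₁) g x) = (⊥ : Submodule ℚ (G → ℚ)) := by
  haveI : Nonempty I := ⟨i₀⟩
  haveI := fun i => finite_span_coeff (G := G) (Φ i)
  have hpair := typeRank_add_typeRank_eq_of_pair h hI h01
  have hcard : Fintype.card I = 2 := by
    classical
    rw [← Finset.card_univ, show (Finset.univ : Finset I) = {i₀, i₁} from Finset.ext fun j => by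
      simpa only [Finset.mem_univ, Finset.mem_insert, Finset.mem_singleton, true_iff] using hI j,
      Finset.card_pair h01]
  rw [← Submodule.finrank_eq_zero, sum_eq_add_of_pair _ hI h01, hcard]
  omega

end Defect

end Literature.NumberTheory.ComplexMultiplication.IrrOdd

end
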